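import Summits.AtomisticToContinuum.HydrodynamicLimit.Theorems.EnskogAdjointDualityAdjointEnskogTestFamilyRRefPsiOperator
import Summits.AtomisticToContinuum.HydrodynamicLimit.Theorems.EnskogAdjointDualityAdjointEnskogTestFamilyRRadialSymmetry
import Summits.AtomisticToContinuum.HydrodynamicLimit.Theorems.EnskogAdjointDualityAdjointEnskogTestFamilyRSphereCalculus
import Literature.Analysis.FunctionSpaces.PeriodicLogCost
import HarnessLib

/-!
# K2R refutation, identity (0), `ψ`-part — preparation I: torus trigonometry and the critical `γ`-term

Route `EnskogAdjointDuality` of `AtomisticToContinuum/HydrodynamicLimit`, crux K2R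
`AdjointEnskogTestFamilyR` (stmt-AtomisticToContinuum-11592), line `refutation`, registered stub
`stub_psiZero` (file 1 of 3; keyed sub-goal `stub_psiZero_prep`).

Testing the defect inequality against `z cos(2πx₀) Θ₀^R(v)`, `Θ₀^R(v) = (1+|v|²)⁻³e^{-|v|²/R}`, the
second spatial difference of the energy coefficient `γ` of `ψ = α + ⟪β,v⟫ + γ|v|²/2` produces the only
`R`-divergent contribution.  This file evaluates it exactly:

* `k2r_ref_p0_cosCoord_sub_proj`, `k2r_ref_p0_integral_cos_mul_sub` — Haar shift on `𝕋³`: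
  `∫ cos(2πx₀)(γ(x + p̄) − γ(x)) dx = (cos(2πp₀) − 1)∫cos(2πx₀)γ + sin(2πp₀)∫sin(2πx₀)γ`;
* `k2r_ref_p0_weight_moments` — `∫ Θ₀ v₀|v|² = 0` and `∫ Θ₀(⟪v,ω⟫₊)³ dv = (π/4)J_R` for every unit
  `ω` (rotation to the pole, `stub_radialSymmetry`, and `stub_sphereCalculus`);
* `k2r_ref_p0_main_term` — Fubini on `(𝕋³ × ℝ³) × S²`:
  `∫∫ c cos(2πx₀)Θ₀(v)∫_{S²}(γ(x+εω) − γ(x))/2 (⟪v,ω⟫₊)³dσ = −c(π/8) μ_ε J_R ∫cos(2πx₀)γ`,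
  `μ_ε = ∫_{S²}(1 − cos(2πεν₀))dσ` (`∫_{S²} sin(2πεν₀)dσ = 0`).

References: C. Cercignani, R. Illner, M. Pulvirenti, *The Mathematical Theory of Dilute Gases* (1994),
§3.1 [CIP1994]; folklore calculus on the flat torus and the sphere.
-/

noncomputable section

open MeasureTheory Set Filter Function Metric
open scoped InnerProductSpace Real

namespace Summit.AtomisticToContinuum.HydrodynamicLimit.Theorems.EnskogAdjointDuality

open Literature.MathematicalPhysics.KineticTheory Literature.Analysis.FluidPDE Literature.Analysis.FunctionSpaces

/-- `cos(2π(x − p̄)₀) = cos(2πx₀)cos(2πp₀) + sin(2πx₀)sin(2πp₀)` on `𝕋³` (`p̄ = proj p`). [folklore] -/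
theorem k2r_ref_p0_cosCoord_sub_proj (x : T3) (p : V3) :
    Torus.cosCoord 0 (x - Torus.proj p) =
      Torus.cosCoord 0 x * Real.cos (2 * π * p 0) + Torus.sinCoord 0 x * Real.sin (2 * π * p 0) := by
  obtain ⟨x₀, hx⟩ := Torus.exists_coe_eq (x 0)
  have h : (x - Torus.proj p) 0 = ((x₀ - p 0 : ℝ) : UnitAddCircle) := by
    rw [Pi.sub_apply, Torus.proj_apply, ← hx]
    norm_cast
  rw [Torus.cosCoord_of_eq h, Torus.cosCoord_of_eq hx.symm, Torus.sinCoord_of_eq hx.symm, mul_sub,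
    Real.cos_sub]

/-- Haar shift of a first spatial difference against `cos(2πx₀)`:
`∫ cos(2πx₀)(γ(x + p̄) − γ(x)) dx = (cos(2πp₀) − 1) ∫ cos(2πx₀)γ + sin(2πp₀) ∫ sin(2πx₀)γ`. [folklore] -/
theorem k2r_ref_p0_integral_cos_mul_sub {γ : T3 → ℝ} (hγ : Continuous γ) (p : V3) :
    ∫ x, Torus.cosCoord 0 x * (γ (x + Torus.proj p) - γ x) =
      (Real.cos (2 * π * p 0) - 1) * (∫ x, Torus.cosCoord 0 x * γ x) +
        Real.sin (2 * π * p 0) * ∫ x, Torus.sinCoord 0 x * γ x := by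
  have hc : Continuous (Torus.cosCoord (0 : Fin 3) : T3 → ℝ) := (Torus.isSmooth_cosCoord 0).continuous
  have hs : Continuous (Torus.sinCoord (0 : Fin 3) : T3 → ℝ) := (Torus.isSmooth_sinCoord 0).continuous
  set P : T3 := Torus.proj p with hP
  have h1 : ∫ x, Torus.cosCoord 0 x * γ (x + P) = ∫ x, Torus.cosCoord 0 (x - P) * γ x := by
    have h := integral_add_right_eq_self (μ := (volume : Measure T3))
      (fun x => Torus.cosCoord 0 (x - P) * γ x) P
    simp only [add_sub_cancel_right] at h
    exact h
  have hi1 : Integrable (fun x => Torus.cosCoord 0 x * γ x) := (hc.mul hγ).integrable_unitAddTorus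
  have hi2 : Integrable (fun x => Torus.cosCoord 0 x * γ (x + P)) :=
    (hc.mul (hγ.comp (continuous_id.add continuous_const))).integrable_unitAddTorus
  have hi3 : Integrable (fun x => Torus.sinCoord 0 x * γ x) := (hs.mul hγ).integrable_unitAddTorus
  calc ∫ x, Torus.cosCoord 0 x * (γ (x + P) - γ x)
      = (∫ x, Torus.cosCoord 0 x * γ (x + P)) - ∫ x, Torus.cosCoord 0 x * γ x := by
        rw [← integral_sub hi2 hi1]
        exact integral_congr_ae (ae_of_all _ fun x => by ring)
    _ = (∫ x, (Real.cos (2 * π * p 0) * (Torus.cosCoord 0 x * γ x) +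
          Real.sin (2 * π * p 0) * (Torus.sinCoord 0 x * γ x))) - ∫ x, Torus.cosCoord 0 x * γ x := by
        rw [h1]
        congr 1
        refine integral_congr_ae (ae_of_all _ fun x => ?_)
        dsimp only
        rw [hP, k2r_ref_p0_cosCoord_sub_proj]
        ring
    _ = _ := by
        rw [integral_add (hi1.const_mul _) (hi3.const_mul _), integral_const_mul, integral_const_mul]
        ring

/-- Two moments of the critical weight `Θ₀^R(v) = (1+|v|²)⁻³e^{-|v|²/R}`: the odd moment
`∫ Θ₀ v₀|v|² dv = 0` and, for every unit `ω`, `∫ Θ₀ (⟪v,ω⟫₊)³ dv = ∫ Θ₀ (v₀)₊³ dv = (π/4) J_R`. [folklore] -/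
theorem k2r_ref_p0_weight_moments {R : ℝ} (hR : 1 ≤ R) :
    (Integrable fun v : V3 => ((1 + ‖v‖ ^ 2) ^ 3)⁻¹ * Real.exp (-‖v‖ ^ 2 / R) * v 0 * ‖v‖ ^ 2) ∧
    (∫ v : V3, ((1 + ‖v‖ ^ 2) ^ 3)⁻¹ * Real.exp (-‖v‖ ^ 2 / R) * v 0 * ‖v‖ ^ 2 = 0) ∧
    ∀ ω : sphere (0 : V3) 1,
      (Integrable fun v : V3 =>
        ((1 + ‖v‖ ^ 2) ^ 3)⁻¹ * Real.exp (-‖v‖ ^ 2 / R) * max ⟪v, (ω : V3)⟫_ℝ 0 ^ 3) ∧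
      ∫ v : V3, ((1 + ‖v‖ ^ 2) ^ 3)⁻¹ * Real.exp (-‖v‖ ^ 2 / R) * max ⟪v, (ω : V3)⟫_ℝ 0 ^ 3 =
        π / 4 * ∫ E in Ioi (0 : ℝ), E ^ 2 * (((1 + E) ^ 3)⁻¹ * Real.exp (-E / R)) := by
  have hR0 : 0 < R := by linarith
  obtain ⟨-, -, -, -, b5, -, -, -, b8⟩ := k2r_ref_R3_facts hR
  have hϑc : Continuous fun E : ℝ => ((1 + |E|) ^ 3)⁻¹ * Real.exp (-E / R) := by
    fun_prop (disch := intros; positivity)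
  have hD : Integrable (fun v : V3 =>
      |(fun E : ℝ => ((1 + |E|) ^ 3)⁻¹ * Real.exp (-E / R)) (‖v‖ ^ 2)| * (1 + ‖v‖ ^ 2) ^ 3) := by
    refine b8.mono' ?_ (ae_of_all _ fun v => ?_)
    · exact (((continuous_abs.comp (hϑc.comp (continuous_norm.pow 2))).mul
        ((continuous_const.add (continuous_norm.pow 2)).pow 3))).aestronglyMeasurable
    · have h1 : (1 + ‖v‖ ^ 2) ^ 3 ≤ (1 + ‖v‖ ^ 2) ^ 4 :=
        pow_le_pow_right₀ (by nlinarith [norm_nonneg v]) (by norm_num)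
      simp only [abs_sq]
      rw [Real.norm_eq_abs, abs_mul, abs_abs, abs_of_nonneg (by positivity),
        abs_of_nonneg (by positivity)]
      exact mul_le_mul_of_nonneg_left h1 (by positivity)
  have hP : Continuous fun a : ℝ => max a 0 ^ 3 := by fun_prop
  have hPle : ∀ a : ℝ, |max a 0 ^ 3| ≤ 1 * (1 + |a|) ^ 3 := fun a => by
    rw [one_mul, abs_pow, abs_of_nonneg (le_max_right _ _)]
    exact pow_le_pow_left₀ (le_max_right _ _)
      (max_le ((le_abs_self a).trans (le_add_of_nonneg_left zero_le_one)) (by positivity)) 3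
  obtain ⟨h1, -, -, h4⟩ := stub_radialSymmetry _ _ 1 hϑc hP hPle hD
  obtain ⟨i1, -, e1, -⟩ := h1 0
  simp only [abs_sq] at i1 e1
  refine ⟨i1, e1, fun ω => ?_⟩
  obtain ⟨i5, -, e5, -, -⟩ := h4 ω
  simp only [abs_sq] at i5 e5
  refine ⟨i5, ?_⟩
  rw [e5]
  exact b5.2

/-- **The critical `γ`-term of identity (0).** For a continuous bounded `γ` on `𝕋³`, `R ≥ 1` and a
constant `c`: the function `(x,v) ↦ c cos(2πx₀) Θ₀^R(v) ∫_{S²} (γ(x+εω) − γ(x))/2 (⟪v,ω⟫₊)³ dσ` is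
integrable on `𝕋³ × ℝ³` and its integral is `−c (π/8) μ_ε J_R ∫ cos(2πx₀)γ`, where
`μ_ε = ∫_{S²}(1 − cos(2πεν₀))dσ`, `J_R = ∫₀^∞ E²(1+E)⁻³e^{-E/R}` (Fubini to `∫_{S²}∫_{𝕋³}∫_{ℝ³}`, Haar
shift on `𝕋³`, rotation of `ω` to the pole, `∫ Θ₀(v₀)₊³ = (π/4)J_R`, `∫ sin(kν₀)dσ = 0`).
[cite: CIP1994, §3.1] -/
theorem k2r_ref_p0_main_term {R ε Cγ : ℝ} (hR : 1 ≤ R) {γ : T3 → ℝ} (hγ : Continuous γ)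
    (hCγ : ∀ x, |γ x| ≤ Cγ) (c : ℝ) :
    Integrable (fun p : T3 × V3 => ((1 + ‖p.2‖ ^ 2) ^ 3)⁻¹ * Real.exp (-‖p.2‖ ^ 2 / R) *
        (c * Torus.cosCoord 0 p.1 *
          ∫ ω : sphere (0 : V3) 1, ((γ (p.1 + Torus.proj (ε • (ω : V3))) - γ p.1) / 2 *
            max ⟪p.2, (ω : V3)⟫_ℝ 0 ^ 3) ∂sphereMeasure)) (volume.prod volume) ∧
    ∫ p : T3 × V3, ((1 + ‖p.2‖ ^ 2) ^ 3)⁻¹ * Real.exp (-‖p.2‖ ^ 2 / R) *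
        (c * Torus.cosCoord 0 p.1 *
          ∫ ω : sphere (0 : V3) 1, ((γ (p.1 + Torus.proj (ε • (ω : V3))) - γ p.1) / 2 *
            max ⟪p.2, (ω : V3)⟫_ℝ 0 ^ 3) ∂sphereMeasure) ∂(volume.prod volume) =
      -(c * (π / 8) * (∫ ν : sphere (0 : V3) 1, (1 - Real.cos (2 * π * ε * (ν : V3) 0)) ∂sphereMeasure) *
        (∫ E in Ioi (0 : ℝ), E ^ 2 * (((1 + E) ^ 3)⁻¹ * Real.exp (-E / R))) *
        ∫ x, Torus.cosCoord 0 x * γ x) := by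
  haveI := isFiniteMeasure_sphereMeasure (E := V3)
  have hcosc : Continuous (Torus.cosCoord (0 : Fin 3) : T3 → ℝ) :=
    (Torus.isSmooth_cosCoord 0).continuous
  have hCγ0 : 0 ≤ Cγ := (abs_nonneg _).trans (hCγ 0)
  set th : V3 → ℝ := fun v => ((1 + ‖v‖ ^ 2) ^ 3)⁻¹ * Real.exp (-‖v‖ ^ 2 / R) with hth
  have hthc : Continuous th := by
    simp only [hth]
    fun_prop (disch := intros; positivity)
  have hth0 : ∀ v, 0 ≤ th v := fun v => by simp only [hth]; positivity
  -- the integrand on `(𝕋³ × ℝ³) × S²`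
  set H : (T3 × V3) × sphere (0 : V3) 1 → ℝ := fun q => th q.1.2 * (c * Torus.cosCoord 0 q.1.1) *
      ((γ (q.1.1 + Torus.proj (ε • (q.2 : V3))) - γ q.1.1) / 2 * max ⟪q.1.2, (q.2 : V3)⟫_ℝ 0 ^ 3)
    with hH
  have hHc : Continuous H := by
    simp only [hH]
    have hp : Continuous fun q : (T3 × V3) × sphere (0 : V3) 1 =>
        q.1.1 + Torus.proj (ε • (q.2 : V3)) :=
      continuous_fst.fst.add (Torus.continuous_proj.comp
        ((continuous_subtype_val.comp continuous_snd).const_smul ε))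
    have h1 : Continuous fun q : (T3 × V3) × sphere (0 : V3) 1 =>
        γ (q.1.1 + Torus.proj (ε • (q.2 : V3))) := hγ.comp hp
    fun_prop
  obtain ⟨-, -, b3, -⟩ := k2r_ref_R3_facts hR
  have hdom : Integrable (fun q : (T3 × V3) × sphere (0 : V3) 1 =>
      |c| * Cγ * (‖q.1.2‖ ^ 3 * th q.1.2))
      (((volume : Measure T3).prod (volume : Measure V3)).prod sphereMeasure) := by
    have h1 : Integrable (fun p : T3 × V3 => ‖p.2‖ ^ 3 * th p.2)
        ((volume : Measure T3).prod (volume : Measure V3)) := b3.1.comp_snd _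
    exact (h1.comp_fst _).const_mul _
  have hHi : Integrable H (((volume : Measure T3).prod (volume : Measure V3)).prod sphereMeasure) := by
    refine hdom.mono' hHc.aestronglyMeasurable (ae_of_all _ fun q => ?_)
    have hω : ‖(q.2 : V3)‖ = 1 := norm_eq_of_mem_sphere q.2
    have hm : |max ⟪q.1.2, (q.2 : V3)⟫_ℝ 0| ≤ ‖q.1.2‖ := by
      rw [abs_of_nonneg (le_max_right _ _)]
      refine max_le ((le_abs_self _).trans ?_) (norm_nonneg _)
      simpa [hω] using abs_real_inner_le_norm q.1.2 (q.2 : V3)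
    have hd : |(γ (q.1.1 + Torus.proj (ε • (q.2 : V3))) - γ q.1.1) / 2| ≤ Cγ := by
      rw [abs_div, abs_two]
      have := (abs_sub _ _).trans (add_le_add (hCγ (q.1.1 + Torus.proj (ε • (q.2 : V3)))) (hCγ q.1.1))
      linarith
    have hcs : |Torus.cosCoord 0 q.1.1| ≤ 1 := Torus.abs_cosCoord_le 0 _
    simp only [hH, Real.norm_eq_abs, abs_mul, abs_pow, abs_of_nonneg (hth0 _)]
    calc th q.1.2 * (|c| * |Torus.cosCoord 0 q.1.1|) *
          (|(γ (q.1.1 + Torus.proj (ε • (q.2 : V3))) - γ q.1.1) / 2| * |max ⟪q.1.2, (q.2 : V3)⟫_ℝ 0| ^ 3)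
        ≤ th q.1.2 * (|c| * 1) * (Cγ * ‖q.1.2‖ ^ 3) := by gcongr
      _ = |c| * Cγ * (‖q.1.2‖ ^ 3 * th q.1.2) := by ring
  have hinner : ∀ p : T3 × V3, ∫ ω, H (p, ω) ∂sphereMeasure = th p.2 * (c * Torus.cosCoord 0 p.1 *
      ∫ ω : sphere (0 : V3) 1, ((γ (p.1 + Torus.proj (ε • (ω : V3))) - γ p.1) / 2 *
        max ⟪p.2, (ω : V3)⟫_ℝ 0 ^ 3) ∂sphereMeasure) := fun p => by
    simp only [hH]
    rw [← integral_const_mul, ← integral_const_mul]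
    exact integral_congr_ae (ae_of_all _ fun ω => by ring)
  refine ⟨?_, ?_⟩
  · have h := hHi.integral_prod_left
    simp only [hinner] at h
    exact h
  -- the value: Fubini to `∫_{S²} ∫_{𝕋³ × ℝ³}`
  obtain ⟨-, -, hmom⟩ := k2r_ref_p0_weight_moments hR
  set Γc : ℝ := ∫ x, Torus.cosCoord 0 x * γ x with hΓc
  set Γs : ℝ := ∫ x, Torus.sinCoord 0 x * γ x with hΓs
  set J : ℝ := ∫ E in Ioi (0 : ℝ), E ^ 2 * (((1 + E) ^ 3)⁻¹ * Real.exp (-E / R)) with hJ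
  have hslice : ∀ ω : sphere (0 : V3) 1,
      ∫ p, H (p, ω) ∂((volume : Measure T3).prod (volume : Measure V3)) =
        (c / 2 * ((Real.cos (2 * π * ε * (ω : V3) 0) - 1) * Γc +
          Real.sin (2 * π * ε * (ω : V3) 0) * Γs)) * (π / 4 * J) := by
    intro ω
    have hsm : (ε • (ω : V3)) 0 = ε * (ω : V3) 0 := by simp
    calc ∫ p, H (p, ω) ∂((volume : Measure T3).prod (volume : Measure V3))
        = ∫ p : T3 × V3, (c * Torus.cosCoord 0 p.1 *
              ((γ (p.1 + Torus.proj (ε • (ω : V3))) - γ p.1) / 2)) *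
            (th p.2 * max ⟪p.2, (ω : V3)⟫_ℝ 0 ^ 3) ∂((volume : Measure T3).prod (volume : Measure V3)) :=
          integral_congr_ae (ae_of_all _ fun p => by simp only [hH]; ring)
      _ = (∫ x : T3, c * Torus.cosCoord 0 x * ((γ (x + Torus.proj (ε • (ω : V3))) - γ x) / 2)) *
            ∫ v : V3, th v * max ⟪v, (ω : V3)⟫_ℝ 0 ^ 3 :=
          integral_prod_mul (μ := (volume : Measure T3)) (ν := (volume : Measure V3))
            (fun x : T3 => c * Torus.cosCoord 0 x * ((γ (x + Torus.proj (ε • (ω : V3))) - γ x) / 2))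
            (fun v : V3 => th v * max ⟪v, (ω : V3)⟫_ℝ 0 ^ 3)
      _ = (c / 2 * ∫ x : T3, Torus.cosCoord 0 x * (γ (x + Torus.proj (ε • (ω : V3))) - γ x)) *
            (π / 4 * J) := by
          have hf : ∫ x : T3, c * Torus.cosCoord 0 x * ((γ (x + Torus.proj (ε • (ω : V3))) - γ x) / 2) =
              c / 2 * ∫ x : T3, Torus.cosCoord 0 x * (γ (x + Torus.proj (ε • (ω : V3))) - γ x) := by
            rw [← integral_const_mul]
            exact integral_congr_ae (ae_of_all _ fun x => by ring)
          rw [(hmom ω).2, hf]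
      _ = _ := by rw [k2r_ref_p0_integral_cos_mul_sub hγ, hsm, ← mul_assoc (2 * π) ε]
  have hswap := integral_integral_swap (μ := (volume : Measure T3).prod (volume : Measure V3))
    (ν := (sphereMeasure : Measure (sphere (0 : V3) 1))) (f := fun p ω => H (p, ω)) hHi
  have hcosS : Continuous fun ω : sphere (0 : V3) 1 => Real.cos (2 * π * ε * (ω : V3) 0) - 1 := by
    fun_prop
  have hsinS : Continuous fun ω : sphere (0 : V3) 1 => Real.sin (2 * π * ε * (ω : V3) 0) := by
    fun_prop
  have hIc : Integrable (fun ω : sphere (0 : V3) 1 => (Real.cos (2 * π * ε * (ω : V3) 0) - 1) * Γc)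
      sphereMeasure :=
    ((hcosS.mul continuous_const).integrable_of_hasCompactSupport (HasCompactSupport.of_compactSpace _))
  have hIs : Integrable (fun ω : sphere (0 : V3) 1 => Real.sin (2 * π * ε * (ω : V3) 0) * Γs)
      sphereMeasure :=
    ((hsinS.mul continuous_const).integrable_of_hasCompactSupport (HasCompactSupport.of_compactSpace _))
  have hcos_int : ∫ ω : sphere (0 : V3) 1, (Real.cos (2 * π * ε * (ω : V3) 0) - 1) ∂sphereMeasure =
      -∫ ω : sphere (0 : V3) 1, (1 - Real.cos (2 * π * ε * (ω : V3) 0)) ∂sphereMeasure := by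
    rw [← integral_neg]
    exact integral_congr_ae (ae_of_all _ fun ω => by ring)
  have hsin_int := (k2r_ref_sphere_odd_vanish 0 (2 * π * ε)).1
  calc ∫ p : T3 × V3, th p.2 * (c * Torus.cosCoord 0 p.1 *
          ∫ ω : sphere (0 : V3) 1, ((γ (p.1 + Torus.proj (ε • (ω : V3))) - γ p.1) / 2 *
            max ⟪p.2, (ω : V3)⟫_ℝ 0 ^ 3) ∂sphereMeasure) ∂(volume.prod volume)
      = ∫ p, ∫ ω, H (p, ω) ∂sphereMeasure ∂((volume : Measure T3).prod (volume : Measure V3)) := by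
        simp only [hinner]
    _ = ∫ ω, ∫ p, H (p, ω) ∂((volume : Measure T3).prod (volume : Measure V3)) ∂sphereMeasure := hswap
    _ = ∫ ω : sphere (0 : V3) 1, (c / 2 * (π / 4 * J)) *
          ((Real.cos (2 * π * ε * (ω : V3) 0) - 1) * Γc + Real.sin (2 * π * ε * (ω : V3) 0) * Γs)
          ∂sphereMeasure :=
        integral_congr_ae (ae_of_all _ fun ω => by dsimp only; rw [hslice ω]; ring)
    _ = _ := by
        rw [integral_const_mul, integral_add hIc hIs, integral_mul_const, integral_mul_const, hcos_int,
          hsin_int]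
        ring

/-- **Registered sub-goal `stub_psiZero_prep`** (keyed theorem of this preparatory file): the Haar
shift of a first spatial difference against `cos(2πx₀)` on `𝕋³`, `k2r_ref_p0_integral_cos_mul_sub`.
[folklore] -/
theorem stub_psiZero_prep : ∀ (γ : UnitAddTorus (Fin 3) → ℝ), Continuous γ →
    ∀ p : EuclideanSpace ℝ (Fin 3), ∫ x : UnitAddTorus (Fin 3), Torus.cosCoord 0 x * (γ (x + Torus.proj p) - γ x) =
      (Real.cos (2 * Real.pi * p 0) - 1) * (∫ x : UnitAddTorus (Fin 3), Torus.cosCoord 0 x * γ x) +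
        Real.sin (2 * Real.pi * p 0) * ∫ x : UnitAddTorus (Fin 3), Torus.sinCoord 0 x * γ x :=
  fun _ hγ p => k2r_ref_p0_integral_cos_mul_sub hγ p

end Summit.AtomisticToContinuum.HydrodynamicLimit.Theorems.EnskogAdjointDuality
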